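import Mathlib
import Summits.Ventures.FusionMHD.Models.RwmFRS1Kq78Solution
import Summits.Ventures.FusionMHD.Models.RwmFRS1Kq78Bessel
import Summits.Ventures.FusionMHD.Models.RwmFRS1Kq08Energy
import HarnessLib

/-!
# F3.r4 instance «RwmFRS1Kq78» (candidate row «F3.r4-KINKEQ78-RWM21»): THE SENTENCES — no-wall instability of the external
# `(2,1)` mode of the `q_a = 7/4 < 2` screw pinch, the ideal-wall window out to `b = 11/10·a`, the critical wall radius
# `b* ∈ (11/10·a, 23/20·a)` — inside BOTH earlier members' (`Kq08`: `(6/5, 13/10)`, `Kq07`: `(31/20, 8/5)`) — and the certified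
# thin-wall RWM growth rates `3.75 < γτ_w < 4.11` at `b = 11/10·a` and `0.57 < γτ_w < 0.6` at `b = 21/20·a`

Assembly file (model-6 g8) of the chain `RwmFRS1Kq78Profile` → `RwmFRS1Kq78` → `…Axis` → `…AxisData` → `…AxisJets` → `…AxisValues` →
`…Chain` → `…Solution` (the axis-regular marginal solution `ξ₁ = Kq78.xi`, odd, `C¹` through the axis, no zero on `(0, a]`,
`6.1356309 < L_78 = aξ₁′/ξ₁(a) < 6.1356310`), with the model-independent `m = 2` wall factors BY NAME: ★ #109's `RwmFRS1Kq07Bessel`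
(`Λ_∞(2, 1/5) ∈ [0.99, 0.9909]`, `Λ_b(2, 1/5, 6/25) ≤ 2.906`) and THIS row's close-wall file `RwmFRS1Kq78Bessel`
(`Λ_b(2, 1/5, 21/100) ∈ [10.0532, 10.3036]`, `Λ_b(2, 1/5, 11/50) ∈ [5.2162, 5.2921]`, `Λ_b(2, 1/5, 23/100) ≤ 3.651`).  It COMPOSES,
BY NAME: lit-4's PROVED external-mode test `ScrewPinch.Profile.newcombExternalModes_iff` [Freidberg2014 §11.5.3 (11.117)–(11.118)]
and `fluidEnergy_eq_boundary_of_solution` (so `δW_∞`, `δW_b` of (11.148)–(11.149) ARE `externalEnergy 2 k 1 Λ ξ₁ = δŴ(L, Λ)·ξ₁(1)²`,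
`δŴ(L, Λ) = (L − 15)/4949 + Λ/2450`, `Kq78.boundaryForm_eq`); lit-3's wall factors [(11.96), (11.150)] with `Λ_∞ < 1` (§8) and the
§12 critical wall radius `Profile.criticalWallRadius`; model-6's `ResistiveWall.IsThinWallRate` [(11.169)]; the admissibility class
`RwmFRS1.IsAdmissible` of row #71; and row #125's `Kq08.criticalWallRadius_bounds` for the cross-row chain.

CERTIFIED SENTENCES (MODEL M_RWM,78 = the EXACT force-balanced `q₀ = 7/8` member `Kq78.P78` (`q = (7/8)(1+r²)`, `q_a = 7/4`,
`β₀ = 1208/30625`; `Kq78.isRadialPressureBalance`) + vacuum + thin resistive wall, `R₀ = 5a` DECLARED; `q₀ = 7/8` and the wall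
radii `b/a ∈ {21/20, 11/10, 23/20}` DECLARED SYNTHETIC; CLASS C = external `(m,n) = (2,1)`, `q = 2` in the vacuum at `r² = 9/7`):
1. `lambdaCrit_bounds` — `Λ_crit = 2450(15 − L_78)/4949 ∈ (4.388301, 4.388302)`;
2. **`dWinf_neg`**, **`noWall_not_stable`** — `δW_∞ < 0` from lit-3's GENERIC `Λ_∞ < 1 < Λ_crit` (VALIDATED: tokamak band (11.221)
   `1.3235 < nq_a = 1.75 < 2`);
3. **`dWb_pos`** (`b = 11/10·a`: `Λ_b ≥ 5.2162 > Λ_crit`), **`idealWall_stable`**, **`idealWall_window`** (every `a < b ≤ 11/10·a`);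
   **`dWb_neg`** (`b = 23/20·a`: `Λ_b ≤ 3.651 < Λ_crit`), **`dWb_neg_far`** (every `b ≥ 23/20·a`); hence
   **`criticalWallRadius_bounds`: `11/10·a < b* < 23/20·a`**, **`idealWall_stable_iff`** (`b < b*`), and the JUXTAPOSITION with
   rows #125/#109 **`criticalWallRadius_lt_Kq08`: `b*(M_RWM,78) < 23/20·a < 6/5·a < b*(M_RWM,8)` (`< 13/10·a < 31/20·a < b*(M_RWM,K)`
   by `Kq08.criticalWallRadius_lt_Kq07`)** — the third kernel point of the `q_a`-trend `7/5 → 8/5 → 7/4` of one family (never merged);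
4. **`rwm_rate_11`** — thin wall at `b = 11/10·a`: every `γ` with `γτ_w·δW_b = −δW_∞` satisfies **`3.75 < γτ_w < 4.11`**;
   **`rwm_rate_105`** — at `b = 21/20·a`: **`0.57 < γτ_w < 0.6`**; `rwm_grows_of_lt` / `rwm_grows` — `γ > 0` for every thin wall
   `a < b < b*` (`τ_w > 0`).
VALIDATED (not load-bearing): float `L = 6.135631`, `Λ_∞ = 0.99045`, `Λ_crit = 4.38830`, `b_crit = 1.1215a`, `γτ_w(11/10·a) = 3.933`,
`γτ_w(21/20·a) = 0.587` (cert/model-6/preview_q0.py, model-6 g8).  HONESTY: the same member's internal `(1,1)` kink (resonant at `q = 1`,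
`r² = 1/7`) is NOT treated here; never «stable/unstable» without «MODEL M_RWM,78, mode (2,1)»; nothing about a device. [instance data]
-/

noncomputable section

open Set Filter Polynomial Literature.Analysis.ODE Literature.Analysis.FunctionSpaces
  Literature.MathematicalPhysics.MHD Literature.MathematicalPhysics.MHD.ScrewPinch
open scoped Topology

namespace Summit.Ventures.FusionMHD.Models

namespace RwmFRS1

namespace Kq78

/-! ### The reference energies of the marginal solution are the boundary form (Freidberg (11.148)) -/

/-- **(11.148) FOR `ξ₁`** (MODEL M_RWM,78, `m = 2`): for every wall factor `Λ`,
`externalEnergy 2 k 1 Λ ξ₁ = δŴ(L_78, Λ)·ξ₁(1)²`, `L_78 = ξ₁′(1)/ξ₁(1)`. [cite: Freidberg2014, §11.5.6 eq. (11.148)] -/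
theorem externalEnergy_xi (Λ : ℝ) :
    P78.externalEnergy 2 kk 1 Λ Kq78.xi = Kq78.boundaryForm (1 * deriv Kq78.xi 1 / Kq78.xi 1) Λ * Kq78.xi 1 ^ 2 := by
  obtain ⟨hBθ, hBz, hp, hBθ0⟩ := profile_regular (51 / 50)
  have hF : ∀ r ∈ Ioc (0 : ℝ) 1, P78.kDotB 2 kk r ≠ 0 := fun r hr => kDotB_ne_zero hr.1 (by nlinarith [hr.1, hr.2])
  have hODE : ∀ r ∈ Ioo (0 : ℝ) 1,
      HasDerivAt (fun s => P78.newcombF 2 kk s * deriv Kq78.xi s) (P78.newcombG 2 kk r * Kq78.xi r) r :=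
    fun r hr => xi_newcomb ⟨hr.1, by linarith [hr.2]⟩
  have hE := Profile.fluidEnergy_eq_boundary_of_solution (P := P78) (m := 2) (k := kk) one_pos
    (by norm_num : (1 : ℝ) < 51 / 50) (by norm_num) hBθ hBz hp hBθ0 hF xi_contDiffOn hODE
  have hx : Kq78.xi 1 ≠ 0 := xi_ne_zero 1 ⟨one_pos, le_rfl⟩
  unfold Profile.externalEnergy
  rw [hE, Kq78.boundaryForm]
  unfold Profile.newcombF
  field_simp
  ring

/-- The NO-WALL reference energy `δW_∞` of the marginal solution (per `2π²R₀/μ₀`), MODEL M_RWM,78, mode `(2,1)`.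
[cite: Freidberg2014, §11.5.6 eq. (11.149)] -/
def dWinf : ℝ := P78.externalEnergy 2 kk 1 (Vacuum.wallFactorInf 2 kk 1) Kq78.xi

/-- The IDEAL-WALL reference energy `δW_b` of the marginal solution, wall at `r = b`, MODEL M_RWM,78, mode `(2,1)`.
[cite: Freidberg2014, §11.5.6 eq. (11.149)] -/
def dWb (b : ℝ) : ℝ := P78.externalEnergy 2 kk 1 (Vacuum.wallFactor 2 kk 1 b) Kq78.xi

/-- `ξ₁(1)² > 0`. [instance data] -/
theorem xi_one_sq_pos : 0 < Kq78.xi 1 ^ 2 := by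
  have := xi_pos one_pos le_rfl
  positivity

/-! ### Sentence 1: the critical wall factor -/

/-- **`Λ_crit ∈ (4.388301, 4.388302)`** (from `6.1356309 < L_78 < 6.1356310`). [instance data] -/
theorem lambdaCrit_bounds : (4388301 / 1000000 : ℝ) < Kq78.lambdaCrit (1 * deriv Kq78.xi 1 / Kq78.xi 1) ∧
    Kq78.lambdaCrit (1 * deriv Kq78.xi 1 / Kq78.xi 1) < (4388302 / 1000000 : ℝ) := by
  obtain ⟨h1, h2⟩ := L_bounds
  unfold Kq78.lambdaCrit
  constructor <;> linarith

/-! ### Sentences 2–3: energies of the marginal solution and the external-mode test -/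

/-- **SENTENCE 2 (no wall): `δW_∞ < 0`** — `Λ_∞ < 1 < Λ_crit` (lit-3's generic bound; no Bessel value needed).
[cite: Freidberg2014, §11.5.6 eq. (11.149), (11.151)] -/
theorem dWinf_neg : Kq78.dWinf < 0 := by
  rw [Kq78.dWinf, externalEnergy_xi]
  have hΛ : Vacuum.wallFactorInf 2 kk 1 < 1 :=
    Vacuum.wallFactorInf_lt_one (by norm_num) (by rw [kk]; norm_num) one_pos
  have hneg : Kq78.boundaryForm (1 * deriv Kq78.xi 1 / Kq78.xi 1) (Vacuum.wallFactorInf 2 kk 1) < 0 := by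
    rw [boundaryForm_neg_iff]
    linarith [lambdaCrit_bounds.1]
  exact mul_neg_of_neg_of_pos hneg xi_one_sq_pos

/-- **SENTENCE 3 (ideal wall at `b = 11/10·a`): `δW_b > 0`** — `Λ_b ≥ 5.2162 > Λ_crit` (this row's close-wall bracket
`Kq78.lambdaWall_22_bounds_sharp`). [cite: Freidberg2014, §11.5.6 eq. (11.149), (11.151)] -/
theorem dWb_pos : 0 < Kq78.dWb (11 / 10) := by
  rw [Kq78.dWb, externalEnergy_xi]
  have hΛ : (26081 / 5000 : ℝ) ≤ Vacuum.wallFactor 2 kk 1 (11 / 10) := by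
    rw [Kq07.wallFactor_two_eq, show (1 / 5 : ℝ) * (11 / 10) = 11 / 50 by norm_num]
    exact lambdaWall_22_bounds_sharp.1
  have hpos : 0 < Kq78.boundaryForm (1 * deriv Kq78.xi 1 / Kq78.xi 1) (Vacuum.wallFactor 2 kk 1 (11 / 10)) := by
    rw [boundaryForm_pos_iff]
    linarith [lambdaCrit_bounds.2]
  exact mul_pos hpos xi_one_sq_pos

/-- **Ideal wall at `b = 23/20·a`: `δW_b < 0`** — `Λ_b ≤ 3.651 < Λ_crit` (wall too far; this row's bracket
`Kq78.lambdaWall_23_bounds_sharp`). [cite: Freidberg2014, §11.5.6 eq. (11.149)] -/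
theorem dWb_neg : Kq78.dWb (23 / 20) < 0 := by
  rw [Kq78.dWb, externalEnergy_xi]
  have hΛ : Vacuum.wallFactor 2 kk 1 (23 / 20) ≤ (3651 / 1000 : ℝ) := by
    rw [Kq07.wallFactor_two_eq, show (1 / 5 : ℝ) * (23 / 20) = 23 / 100 by norm_num]
    exact lambdaWall_23_bounds_sharp.2
  have hneg : Kq78.boundaryForm (1 * deriv Kq78.xi 1 / Kq78.xi 1) (Vacuum.wallFactor 2 kk 1 (23 / 20)) < 0 := by
    rw [boundaryForm_neg_iff]
    linarith [lambdaCrit_bounds.1]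
  exact mul_neg_of_neg_of_pos hneg xi_one_sq_pos

/-- The marginal solution `ξ₁` is admissible (row #71's class `RwmFRS1.IsAdmissible`). [instance data] -/
theorem xi_admissible : IsAdmissible Kq78.xi :=
  ⟨xi_contDiffOn, 1, ⟨zero_le_one, le_rfl⟩, xi_ne_zero 1 ⟨one_pos, le_rfl⟩⟩

/-- **NEWCOMB'S EXTERNAL-MODE TEST FOR MODEL M_RWM,78, MODE `(2,1)`** (lit-4's `newcombExternalModes_iff` instantiated with
the kernel solution `ξ₁`): for every wall factor `Λ`, ALL admissible displacements have positive external energy iff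
`δŴ(L_78, Λ)·ξ₁(1)² > 0`. [cite: Freidberg2014, §11.5.3 eq. (11.118)] -/
theorem externalModes_iff (Λ : ℝ) :
    (∀ ξ : ℝ → ℝ, IsAdmissible ξ → 0 < P78.externalEnergy 2 kk 1 Λ ξ) ↔
      0 < Kq78.boundaryForm (1 * deriv Kq78.xi 1 / Kq78.xi 1) Λ * Kq78.xi 1 ^ 2 := by
  obtain ⟨hBθ, hBz, hp, hBθ0⟩ := profile_regular (51 / 50)
  have hF : ∀ r ∈ Ioc (0 : ℝ) 1, P78.kDotB 2 kk r ≠ 0 := fun r hr => kDotB_ne_zero hr.1 (by nlinarith [hr.1, hr.2])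
  have hODE : ∀ r ∈ Ioo (0 : ℝ) 1,
      HasDerivAt (fun s => P78.newcombF 2 kk s * deriv Kq78.xi s) (P78.newcombG 2 kk r * Kq78.xi r) r :=
    fun r hr => xi_newcomb ⟨hr.1, by linarith [hr.2]⟩
  have h := Profile.newcombExternalModes_iff (P := P78) (m := 2) (k := kk) one_pos (by norm_num : (1 : ℝ) < 51 / 50)
    (by norm_num) hBθ hBz hp hBθ0 hF xi_contDiffOn hODE xi_ne_zero Λ
  rw [boundaryForm_mul] at h
  constructor
  · intro hall
    exact h.1 fun ξ hξ hne => hall ξ ⟨hξ, hne⟩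
  · intro hpos ξ hξ
    exact h.2 hpos ξ hξ.1 hξ.2

/-- **SENTENCE 2′ (no wall): NOT every admissible displacement has positive no-wall energy** — `ξ₁` itself has
`δW_∞ < 0` (the external `(2,1)` kink side of MODEL M_RWM,78; never «the device is unstable»).
[cite: Freidberg2014, §11.5.6 eq. (11.151)] -/
theorem noWall_not_stable :
    ¬ (∀ ξ : ℝ → ℝ, IsAdmissible ξ → 0 < P78.externalEnergy 2 kk 1 (Vacuum.wallFactorInf 2 kk 1) ξ) := by
  intro hall
  have h := hall Kq78.xi xi_admissible
  have h2 := dWinf_neg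
  rw [Kq78.dWinf] at h2
  linarith

/-- **SENTENCE 3′ (ideal wall at `b = 11/10·a`): EVERY admissible displacement has positive ideal-wall energy** in MODEL
M_RWM,78, mode `(2,1)` (wall-stabilised side). [cite: Freidberg2014, §11.5.6 eq. (11.151)] -/
theorem idealWall_stable :
    ∀ ξ : ℝ → ℝ, IsAdmissible ξ → 0 < P78.externalEnergy 2 kk 1 (Vacuum.wallFactor 2 kk 1 (11 / 10)) ξ := by
  have h := dWb_pos
  rw [Kq78.dWb, externalEnergy_xi] at h
  exact (externalModes_iff _).2 h

/-- **THE IDEAL-WALL WINDOW**: for every DECLARED wall radius `a < b ≤ 11/10·a` all admissible displacements have positive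
energy in MODEL M_RWM,78, mode `(2,1)` (`Λ_b` is decreasing in `b`, lit-3 `strictAntiOn_wallFactor`).
[cite: Freidberg2014, §11.5.6 eq. (11.150)–(11.151)] -/
theorem idealWall_window {b : ℝ} (hb1 : 1 < b) (hb2 : b ≤ 11 / 10) :
    ∀ ξ : ℝ → ℝ, IsAdmissible ξ → 0 < P78.externalEnergy 2 kk 1 (Vacuum.wallFactor 2 kk 1 b) ξ := by
  have hk : kk ≠ 0 := by rw [kk]; norm_num
  have hmono := Vacuum.strictAntiOn_wallFactor (m := 2) (by norm_num) hk one_pos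
  have hΛ : Vacuum.wallFactor 2 kk 1 (11 / 10) ≤ Vacuum.wallFactor 2 kk 1 b := by
    rcases eq_or_lt_of_le hb2 with h | h
    · rw [h]
    · exact (hmono (show (1 : ℝ) < b from hb1) (show (1 : ℝ) < 11 / 10 by norm_num) h).le
  have h32 := dWb_pos
  rw [Kq78.dWb, externalEnergy_xi] at h32
  refine (externalModes_iff _).2 ?_
  have hx := xi_one_sq_pos
  have hmonoB := (boundaryForm_strictMono (1 * deriv Kq78.xi 1 / Kq78.xi 1)).monotone hΛ
  have : 0 < Kq78.boundaryForm (1 * deriv Kq78.xi 1 / Kq78.xi 1) (Vacuum.wallFactor 2 kk 1 (11 / 10)) :=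
    pos_of_mul_pos_left h32 hx.le
  exact mul_pos (lt_of_lt_of_le this hmonoB) hx

/-- **Far walls do not stabilise**: for every `b ≥ 23/20·a` the marginal solution `ξ₁` has negative ideal-wall energy
(MODEL M_RWM,78, mode `(2,1)`). [cite: Freidberg2014, §11.5.6 eq. (11.150)] -/
theorem dWb_neg_far {b : ℝ} (hb : 23 / 20 ≤ b) : Kq78.dWb b < 0 := by
  have hk : kk ≠ 0 := by rw [kk]; norm_num
  have hmono := Vacuum.strictAntiOn_wallFactor (m := 2) (by norm_num) hk one_pos
  have hΛ : Vacuum.wallFactor 2 kk 1 b ≤ Vacuum.wallFactor 2 kk 1 (23 / 20) := by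
    rcases eq_or_lt_of_le hb with h | h
    · rw [h]
    · exact (hmono (show (1 : ℝ) < 23 / 20 by norm_num) (show (1 : ℝ) < b by linarith) h).le
  have h74 := dWb_neg
  rw [Kq78.dWb, externalEnergy_xi] at h74 ⊢
  have hx := xi_one_sq_pos
  have hmonoB := (boundaryForm_strictMono (1 * deriv Kq78.xi 1 / Kq78.xi 1)).monotone hΛ
  have : Kq78.boundaryForm (1 * deriv Kq78.xi 1 / Kq78.xi 1) (Vacuum.wallFactor 2 kk 1 (23 / 20)) < 0 :=
    neg_of_mul_neg_left (by linarith) hx.le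
  exact mul_neg_of_neg_of_pos (lt_of_le_of_lt hmonoB this) hx

/-! ### The critical wall radius `b*` (lit-3 §12, by name) -/

/-- The hypotheses of lit-3's critical-wall theorems for the `(2,1)` marginal solution of MODEL M_RWM,78: `F_a ≠ 0`, `ξ₁(a) ≠ 0`,
`δW_∞ < 0` (mode number as the natural number `2`). [instance data] -/
theorem criticalWall_hyps : P78.kDotB ((2 : ℕ) : ℝ) kk 1 ≠ 0 ∧ Kq78.xi 1 ≠ 0 ∧
    P78.externalEnergy ((2 : ℕ) : ℝ) kk 1 (Vacuum.wallFactorInf 2 kk 1) Kq78.xi < 0 := by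
  have h1 : P78.kDotB 2 kk 1 ≠ 0 := by rw [edge_values.1]; norm_num
  have h3 := dWinf_neg
  rw [Kq78.dWinf] at h3
  refine ⟨?_, xi_ne_zero 1 ⟨one_pos, le_rfl⟩, ?_⟩
  · simpa only [Nat.cast_ofNat] using h1
  · simpa only [Nat.cast_ofNat] using h3

/-- **`δW_b > 0 ⇔ b < b*`** for every wall `b > a = 1` (MODEL M_RWM,78, mode `(2,1)`).
[cite: Freidberg2014, §11.5.6 eqs. (11.149)–(11.151), p. 491] -/
theorem dWb_pos_iff {b : ℝ} (hb : 1 < b) : 0 < Kq78.dWb b ↔ b < P78.criticalWallRadius 2 kk 1 Kq78.xi := by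
  obtain ⟨hF, hξ, hinf⟩ := criticalWall_hyps
  have hk : kk ≠ 0 := by rw [kk]; norm_num
  have h := P78.externalEnergy_wall_pos_iff (m := 2) (by norm_num) hk one_pos hF hξ hinf hb
  rw [Kq78.dWb]
  simpa only [Nat.cast_ofNat] using h

/-- **`δW_b < 0 ⇔ b* < b`** for every wall `b > a = 1` (MODEL M_RWM,78, mode `(2,1)`).
[cite: Freidberg2014, §11.5.6 eqs. (11.149)–(11.151), p. 491] -/
theorem dWb_neg_iff {b : ℝ} (hb : 1 < b) : Kq78.dWb b < 0 ↔ P78.criticalWallRadius 2 kk 1 Kq78.xi < b := by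
  obtain ⟨hF, hξ, hinf⟩ := criticalWall_hyps
  have hk : kk ≠ 0 := by rw [kk]; norm_num
  have h := P78.externalEnergy_wall_neg_iff (m := 2) (by norm_num) hk one_pos hF hξ hinf hb
  rw [Kq78.dWb]
  simpa only [Nat.cast_ofNat] using h

/-- **`11/10·a < b* < 23/20·a`**: the critical wall radius of the `(2,1)` mode of MODEL M_RWM,78 lies strictly between two
DECLARED wall radii (`δW_b(11/10) > 0`, `δW_b(23/20) < 0`; VALIDATED float `1.1215a`). [instance data] -/
theorem criticalWallRadius_bounds : (11 / 10 : ℝ) < P78.criticalWallRadius 2 kk 1 Kq78.xi ∧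
    P78.criticalWallRadius 2 kk 1 Kq78.xi < (23 / 20 : ℝ) :=
  ⟨(dWb_pos_iff (by norm_num)).1 dWb_pos, (dWb_neg_iff (by norm_num)).1 dWb_neg⟩

/-- **IDEAL-WALL STABILITY ⇔ WALL INSIDE THE CRITICAL RADIUS**: for every wall `b > a = 1`, ALL admissible displacements
have positive ideal-wall energy in MODEL M_RWM,78, mode `(2,1)`, iff `b < b*`.
[cite: Freidberg2014, §11.5.3 eq. (11.118); §11.5.6 p. 491] -/
theorem idealWall_stable_iff {b : ℝ} (hb : 1 < b) :
    (∀ ξ : ℝ → ℝ, IsAdmissible ξ → 0 < P78.externalEnergy 2 kk 1 (Vacuum.wallFactor 2 kk 1 b) ξ) ↔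
      b < P78.criticalWallRadius 2 kk 1 Kq78.xi := by
  rw [externalModes_iff, ← externalEnergy_xi, ← dWb_pos_iff hb, Kq78.dWb]

/-! ### Sentence 4: the thin-wall resistive wall mode (Freidberg (11.169)) -/

/-- **THE RWM GROWS FOR EVERY THIN WALL INSIDE THE CRITICAL RADIUS** (`1 < b < b*`, MODEL M_RWM,78, mode `(2,1)`): every `γ`
of the printed relation `γτ_w·δW_b = −δW_∞` with `τ_w > 0` is positive. [cite: Freidberg2014, §11.5.6 eq. (11.169), p. 492] -/
theorem rwm_grows_of_lt {b γ τw : ℝ} (hb : 1 < b) (hlt : b < P78.criticalWallRadius 2 kk 1 Kq78.xi) (hτ : 0 < τw)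
    (h : ResistiveWall.IsThinWallRate Kq78.dWinf (Kq78.dWb b) τw γ) : 0 < γ :=
  h.growth_pos hτ dWinf_neg ((dWb_pos_iff hb).2 hlt)

/-- The rate identity: at a wall `b` with bracket `Λ_b ∈ [lo, up]`, `lo > Λ_crit`, every thin-wall rate satisfies
`(Λ_c⁻ − Λ_∞⁺)/(up − Λ_c⁻) < γτ_w < (Λ_c⁺ − Λ_∞⁻)/(lo − Λ_c⁺)` — here packaged as the linear facts used twice below.
[cite: Freidberg2014, §11.5.6 eq. (11.169)] -/
theorem rate_key {γ τw b : ℝ} (h : ResistiveWall.IsThinWallRate Kq78.dWinf (Kq78.dWb b) τw γ) :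
    γ * τw * (Vacuum.lambdaWall 2 (1 / 5) (1 / 5 * b) - Kq78.lambdaCrit (1 * deriv Kq78.xi 1 / Kq78.xi 1)) =
      Kq78.lambdaCrit (1 * deriv Kq78.xi 1 / Kq78.xi 1) - Vacuum.lambdaInf 2 (1 / 5) := by
  unfold ResistiveWall.IsThinWallRate at h
  rw [Kq78.dWinf, Kq78.dWb, externalEnergy_xi, externalEnergy_xi, Kq07.wallFactorInf_two_eq, Kq07.wallFactor_two_eq,
    boundaryForm_eq_sub, boundaryForm_eq_sub] at h
  have hX0 : Kq78.xi 1 ^ 2 ≠ 0 := xi_one_sq_pos.ne'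
  set Lc := Kq78.lambdaCrit (1 * deriv Kq78.xi 1 / Kq78.xi 1)
  set Li := Vacuum.lambdaInf 2 (1 / 5)
  set Lb := Vacuum.lambdaWall 2 (1 / 5) (1 / 5 * b)
  set X := Kq78.xi 1 ^ 2
  have h' : γ * τw * ((Lb - Lc) / 2450 * X) = -((Li - Lc) / 2450 * X) := h
  field_simp at h'
  linarith

/-- **SENTENCE 4: THE CERTIFIED RWM RATE AT `b = 11/10·a`: `3.75 < γτ_w < 4.11`** (`γτ_w = (Λ_crit − Λ_∞)/(Λ_b − Λ_crit)` with
`Λ_∞ ∈ [0.99, 0.9909]`, `Λ_b(11/50) ∈ [5.2162, 5.2921]` (`Kq78.lambdaWall_22_bounds_sharp`), `Λ_crit ∈ (4.388301, 4.388302)`;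
VALIDATED float `3.933`). [cite: Freidberg2014, §11.5.6 eq. (11.169)] -/
theorem rwm_rate_11 {γ τw : ℝ} (h : ResistiveWall.IsThinWallRate Kq78.dWinf (Kq78.dWb (11 / 10)) τw γ) :
    (15 / 4 : ℝ) < γ * τw ∧ γ * τw < (411 / 100 : ℝ) := by
  have key := rate_key h
  rw [show (1 / 5 : ℝ) * (11 / 10) = 11 / 50 by norm_num] at key
  obtain ⟨hc1, hc2⟩ := lambdaCrit_bounds
  obtain ⟨hi1, hi2⟩ := Kq07.lambdaInf_two_bounds
  obtain ⟨hb1, hb2⟩ := lambdaWall_22_bounds_sharp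
  set Lc := Kq78.lambdaCrit (1 * deriv Kq78.xi 1 / Kq78.xi 1)
  set Li := Vacuum.lambdaInf 2 (1 / 5)
  set Lb := Vacuum.lambdaWall 2 (1 / 5) (11 / 50)
  have hd : 0 < Lb - Lc := by linarith
  constructor
  · by_contra hle
    rw [not_lt] at hle
    have : γ * τw * (Lb - Lc) ≤ 15 / 4 * (Lb - Lc) := mul_le_mul_of_nonneg_right hle hd.le
    nlinarith
  · by_contra hle
    rw [not_lt] at hle
    have : 411 / 100 * (Lb - Lc) ≤ γ * τw * (Lb - Lc) := mul_le_mul_of_nonneg_right hle hd.le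
    nlinarith

/-- **THE CERTIFIED RWM RATE AT `b = 21/20·a`: `0.57 < γτ_w < 0.6`** (`Λ_b(21/100) ∈ [10.0532, 10.3036]`, `Kq78.lambdaWall_21_bounds_sharp`;
VALIDATED float `0.587`). [cite: Freidberg2014, §11.5.6 eq. (11.169)] -/
theorem rwm_rate_105 {γ τw : ℝ} (h : ResistiveWall.IsThinWallRate Kq78.dWinf (Kq78.dWb (21 / 20)) τw γ) :
    (57 / 100 : ℝ) < γ * τw ∧ γ * τw < (3 / 5 : ℝ) := by
  have key := rate_key h
  rw [show (1 / 5 : ℝ) * (21 / 20) = 21 / 100 by norm_num] at key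
  obtain ⟨hc1, hc2⟩ := lambdaCrit_bounds
  obtain ⟨hi1, hi2⟩ := Kq07.lambdaInf_two_bounds
  obtain ⟨hb1, hb2⟩ := lambdaWall_21_bounds_sharp
  set Lc := Kq78.lambdaCrit (1 * deriv Kq78.xi 1 / Kq78.xi 1)
  set Li := Vacuum.lambdaInf 2 (1 / 5)
  set Lb := Vacuum.lambdaWall 2 (1 / 5) (21 / 100)
  have hd : 0 < Lb - Lc := by linarith
  constructor
  · by_contra hle
    rw [not_lt] at hle
    have : γ * τw * (Lb - Lc) ≤ 57 / 100 * (Lb - Lc) := mul_le_mul_of_nonneg_right hle hd.le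
    nlinarith
  · by_contra hle
    rw [not_lt] at hle
    have : 3 / 5 * (Lb - Lc) ≤ γ * τw * (Lb - Lc) := mul_le_mul_of_nonneg_right hle hd.le
    nlinarith

/-- **The RWM grows at the DECLARED thin wall `b = 11/10·a`** (inside `b*`), `τ_w > 0`.
[cite: Freidberg2014, §11.5.6 eq. (11.169)] -/
theorem rwm_grows {γ τw : ℝ} (hτ : 0 < τw) (h : ResistiveWall.IsThinWallRate Kq78.dWinf (Kq78.dWb (11 / 10)) τw γ) :
    0 < γ :=
  rwm_grows_of_lt (by norm_num) (by linarith [criticalWallRadius_bounds.1]) hτ h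

/-! ### The typed margin schemas of `ResistiveSchemas.lean` instantiated (model-6's «margin m for E against class C») -/

/-- The RWM data of MODEL M_RWM,78 for CLASS C = {`(2,1)`} with the wall at `r = b`: the two printed reference energies of
the marginal solution. [instance data] -/
def rwmData (b : ℝ) : ResistiveSchemas.RWMData (ℕ × ℕ) := ⟨{(2, 1)}, fun _ => Kq78.dWinf, fun _ => Kq78.dWb b⟩

/-- **NO-WALL SCHEMA: the printed criterion `δW_∞ > 0` FAILS** on CLASS C = {`(2,1)`} of MODEL M_RWM,78 (every wall `b`).
[cite: Freidberg2014, §11.5.6 eq. (11.151)] -/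
theorem noWallSchema_not_criterionHolds (b : ℝ) :
    ¬ (ResistiveSchemas.rwmNoWallSchema (ℕ × ℕ)).CriterionHolds (Kq78.rwmData b) := by
  intro h
  have h21 := h (2, 1) (by simp [ResistiveSchemas.rwmNoWallSchema, Kq78.rwmData])
  simp only [ResistiveSchemas.rwmNoWallSchema, Kq78.rwmData] at h21
  linarith [dWinf_neg]

/-- **IDEAL-WALL SCHEMA: the criterion `δW_b > 0` HOLDS WITH A POSITIVE MARGIN at `b = 11/10·a`** (margin `m = δW_b(11/10) > 0`
itself) on CLASS C = {`(2,1)`} of MODEL M_RWM,78. [cite: Freidberg2014, §11.5.6 eq. (11.151)] -/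
theorem idealWallSchema_hasPositiveMargin :
    (ResistiveSchemas.rwmIdealWallSchema (ℕ × ℕ)).HasPositiveMargin (Kq78.rwmData (11 / 10)) := by
  refine ⟨Kq78.dWb (11 / 10), dWb_pos, fun i hi => ?_⟩
  simp [ResistiveSchemas.rwmIdealWallSchema, Kq78.rwmData]

/-- **IDEAL-WALL SCHEMA ⇔ WALL INSIDE `b*`**: for every wall `b > a`, the printed ideal-wall criterion holds on CLASS C of MODEL
M_RWM,78 iff `b < b*`. [cite: Freidberg2014, §11.5.6 p. 491] -/
theorem idealWallSchema_criterionHolds_iff {b : ℝ} (hb : 1 < b) :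
    (ResistiveSchemas.rwmIdealWallSchema (ℕ × ℕ)).CriterionHolds (Kq78.rwmData b) ↔
      b < P78.criticalWallRadius 2 kk 1 Kq78.xi := by
  rw [← dWb_pos_iff hb]
  constructor
  · intro h
    have h21 := h (2, 1) (by simp [ResistiveSchemas.rwmIdealWallSchema, Kq78.rwmData])
    simpa [ResistiveSchemas.rwmIdealWallSchema, Kq78.rwmData] using h21
  · intro h i hi
    simpa [ResistiveSchemas.rwmIdealWallSchema, Kq78.rwmData] using h

/-! ### Juxtaposition with rows #125 / #109 (the `q_a = 8/5` and `7/5` members): the third point of the `q_a`-trend -/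

/-- **THE WALL MUST COME CLOSER STILL**: `b*(M_RWM,78) < 23/20·a < 6/5·a < b*(M_RWM,8)` (row #125's
`Kq08.criticalWallRadius_bounds`, by name); with #125's `Kq08.criticalWallRadius_lt_Kq07` the three members' critical walls are
ordered `b*(q_a = 7/4) < b*(q_a = 8/5) < b*(q_a = 7/5)` — three kernel rows about three members of one family, never merged.
[instance data] -/
theorem criticalWallRadius_lt_Kq08 :
    P78.criticalWallRadius 2 kk 1 Kq78.xi < Kq08.P8.criticalWallRadius 2 kk 1 Kq08.xi := by
  have h78 := criticalWallRadius_bounds.2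
  have h8 := Kq08.criticalWallRadius_bounds.1
  linarith

/-- … and hence `b*(M_RWM,78) < b*(M_RWM,K)` (★ #109's `q_a = 7/5` member). [instance data] -/
theorem criticalWallRadius_lt_Kq07 :
    P78.criticalWallRadius 2 kk 1 Kq78.xi < Kq07.PK.criticalWallRadius 2 kk 1 Kq07.xi :=
  lt_trans criticalWallRadius_lt_Kq08 Kq08.criticalWallRadius_lt_Kq07

end Kq78

end RwmFRS1

end Summit.Ventures.FusionMHD.Models

end
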